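import Summits.AtomisticToContinuum.FouriersLaw.Theorems.HonestZwanzigRobinCoercivityTransferA
import Summits.AtomisticToContinuum.FouriersLaw.Theorems.HonestZwanzigRobinCoercivityStubBlockForm
import Summits.AtomisticToContinuum.FouriersLaw.Theorems.HonestZwanzigRobinCoercivityStubToeplitzSymbol
import Summits.AtomisticToContinuum.FouriersLaw.Theorems.HonestZwanzigRobinCoercivityPointwise

/-!
# `HonestZwanzig.RobinCoercivity`, line `limit-operator-memory-form` — the four limit-operator INPUTS and the TRANSFER THEOREM

Definitions-and-transfer file for the crux `stmt-AtomisticToContinuum-12695` (`RobinCoercivity` of route `HonestZwanzig`, sub-problem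
`FouriersLaw`), line card `Cruxes/RobinCoercivity/Lines/limit-operator-memory-form.md`, registered skeleton
`Cruxes/RobinCoercivity/Lines/limit_operator_memory_form.lean` (rev 2). The transfer theorem
`Robin.robinCoercivity_of_limitOperatorInputs` (this file, after `final_fixedN` = the fixed-`(N,s)` assembly) proves
`BlockBandDomination → BlockBulkLimit → BulkSymbolPositivity → CornerCoercivity → RobinCoercivity`; the four Props below
are VERBATIM the statements of the skeleton's four open stubs `stub_bandDomination` (U′), `stub_bulkLimit` (L),
`stub_symbolPositivity` (Q1), `stub_cornerCoercivity` (Q2), so that planners can file them as items by name.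

Common objects (all over the route decl's own `let`-gadgets, made `∀`-quantified with their defining equations): for
`pinnedChain ω₂ lam β γ` with Langevin baths at temperature `T` at both ends and `N ≥ 2` sites, `lap_s` = Laplace transform
of the equilibrium time correlation, `e_x` = split site energies, `G(s) = [lap_s(e_x,e_y)]`, `schur_s(f,h) = lap_s(f,h) −
lap_s(f,e)·G(s)⁻¹·lap_s(e,h)` (Feshbach projection orthogonal to the energies); POSITIONS `i : Fin (N+1)` (`0` = left
contact, `1 … N−1` = bonds `b = i − 1`, `N` = right contact) carry the observables `g_i` = bond current `j_{i−1}` at a bond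
position, `γ(T − p_c²)` at a contact; the BLOCK MEMORY MATRIX is `W_N(s)_{ij} = γT²·[i = j contact] − schur_s(g_i∘Θ, g_j)`,
`Θ(q,p) = (q,−p)`. By `Robin.stub_blockForm` (landed) `ξᵀ𝔽_N(s)ξ = s·ξᵀCov(e,e)ξ + (Bξ)ᵀW_N(s)(Bξ)` with `|Bξ|²` the
crux's Robin form, so `RobinCoercivity` is N-uniform coercivity of `W_N(0⁺)` on `Ran B`.

(U′) and (L) are the route's rank-2 crux `OrthogonalOhm` (stmt-AtomisticToContinuum-12693) in matrix form — its foreseen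
UniformLocality / BulkLimit clauses extended from row sums to entries and to the contact rows (cf. the Props
`OrthogonalOhmLine.MemoryKernelLocality` / `MemoryKernelBulkLimit` in `Cruxes/OrthogonalOhm/Lines/SketchResiduals.lean`);
(Q1) at `θ = 0` is the rank-3 crux `PositiveMemory` (stmt-AtomisticToContinuum-12694) in another normalisation, and its
lower half `0 ≤ K̂` is landed (`Robin.symbol_nonneg_of_bulkLimit`); (Q2) is this crux's own boundary residue (where `γ > 0`
is load-bearing). All four are OPEN (N-uniform statements about the deterministic anharmonic bulk / its contacts; barriers
`FixedLengthNoConductivityControl`, `MacroErgodicityHypothesis`); their conjunction is strictly stronger than the crux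
(false at the harmonic point `lam = β = 0`, where the crux holds).
-/

noncomputable section

open MeasureTheory Finset Matrix Filter Topology
open Literature.MathematicalPhysics.KineticTheory.HeatConduction
open Summit.AtomisticToContinuum.FouriersLaw.Theses.HonestZwanzig

namespace Summit.AtomisticToContinuum.FouriersLaw.Theorems.HonestZwanzig.Robin

/-- **(U′) uniform band-domination of the block memory matrix** (= registered stub `stub_bandDomination` of line
`limit-operator-memory-form`): for `pinnedChain ω₂ lam β γ` (all `> 0`) and `T > 0` there is a tail profile `τ : ℕ → ℝ`,
`τ(d) → 0`, such that for every `N ≥ 2` and all small `s > 0` every row of `W_N(s)` has off-band ℓ¹ tail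
`Σ_{j : |i−j| > d} |W_N(s)_{ij}| ≤ τ(d)` (all `d`; `d = 0` is the uniform off-diagonal row bound). Open (rank-2 class). -/
def BlockBandDomination : Prop :=
  ∀ ω₂ lam β γ : ℝ, 0 < ω₂ → 0 < lam → 0 < β → 0 < γ → ∀ T : ℝ, 0 < T →
  ∃ τ : ℕ → ℝ, Tendsto τ atTop (𝓝 0) ∧ ∀ N : ℕ, 2 ≤ N → ∃ s₀ : ℝ, 0 < s₀ ∧
  ∀ (lap : ℝ → (PhaseSpace N → ℝ) → (PhaseSpace N → ℝ) → ℝ) (e : Fin N → PhaseSpace N → ℝ)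
  (G : ℝ → Matrix (Fin N) (Fin N) ℝ) (schur : ℝ → (PhaseSpace N → ℝ) → (PhaseSpace N → ℝ) → ℝ)
  (g : Fin (N + 1) → PhaseSpace N → ℝ) (W : ℝ → Fin (N + 1) → Fin (N + 1) → ℝ),
  (∀ s f₁ f₂, lap s f₁ f₂ = ∫ t in Set.Ioi (0 : ℝ), Real.exp (-(s * t)) *
  ((∫ z, f₁ z * (∫ y, f₂ y ∂((pinnedChain ω₂ lam β γ).transitionKernel N T T t.toNNReal z))
  ∂(pinnedChain ω₂ lam β γ).gibbsMeasure N T) -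
  (∫ z, f₁ z ∂(pinnedChain ω₂ lam β γ).gibbsMeasure N T) *
  (∫ z, f₂ z ∂(pinnedChain ω₂ lam β γ).gibbsMeasure N T))) →
  (∀ x z, e x z = z.2 x ^ 2 / 2 + (pinnedChain ω₂ lam β γ).U (z.1 x) +
  ∑ j : Fin N, ((if j.val = x.val + 1 then (pinnedChain ω₂ lam β γ).V (z.1 j - z.1 x) / 2 else 0) +
  (if x.val = j.val + 1 then (pinnedChain ω₂ lam β γ).V (z.1 x - z.1 j) / 2 else 0))) →
  (∀ s, G s = Matrix.of fun x y => lap s (e x) (e y)) →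
  (∀ s f₁ f₂, schur s f₁ f₂ = lap s f₁ f₂ - ∑ x, ∑ y, lap s f₁ (e x) * (G s)⁻¹ x y * lap s (e y) f₂) →
  (∀ i z, g i z = (∑ b : Fin N, if b.val + 1 = i.val then (pinnedChain ω₂ lam β γ).bondCurrent N b z else 0) +
  (∑ x : Fin N, if (i.val = 0 ∧ x.val = 0) ∨ (i.val = N ∧ x.val + 1 = N) then
  (pinnedChain ω₂ lam β γ).γ * (T - z.2 x ^ 2) else 0)) →
  (∀ s i j, W s i j = (if i = j ∧ (i.val = 0 ∨ i.val = N) then (pinnedChain ω₂ lam β γ).γ * T ^ 2 else 0) -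
  schur s (fun z => g i (z.1, -z.2)) (g j)) →
  ∀ s : ℝ, 0 < s → s < s₀ → ∀ (i : Fin (N + 1)) (d : ℕ),
  ∑ j : Fin (N + 1), (if (d : ℝ) < |(i.val : ℝ) - j.val| then |W s i j| else 0) ≤ τ d

/-- **(L) bulk Toeplitz limit of the block memory matrix at every fixed distance** (= registered stub `stub_bulkLimit`,
rev 2): there is a summable `K_∞ : ℤ → ℝ` such that for every `ε > 0` and every distance bound `Z` there is `R` with: for all
`N ≥ 2` and small `s > 0`, `|W_N(s)_{ij} − K_∞(i − j)| ≤ ε` for all bond positions `i, j` at distance `≥ R` from both ends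
and `|i − j| ≤ Z`. `K_∞` is unique when it exists. Open (rank-2 class). -/
def BlockBulkLimit : Prop :=
  ∀ ω₂ lam β γ : ℝ, 0 < ω₂ → 0 < lam → 0 < β → 0 < γ → ∀ T : ℝ, 0 < T →
  ∃ K : ℤ → ℝ, Summable K ∧ ∀ ε : ℝ, 0 < ε → ∀ Z : ℕ, ∃ R : ℕ, ∀ N : ℕ, 2 ≤ N → ∃ s₀ : ℝ, 0 < s₀ ∧
  ∀ (lap : ℝ → (PhaseSpace N → ℝ) → (PhaseSpace N → ℝ) → ℝ) (e : Fin N → PhaseSpace N → ℝ)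
  (G : ℝ → Matrix (Fin N) (Fin N) ℝ) (schur : ℝ → (PhaseSpace N → ℝ) → (PhaseSpace N → ℝ) → ℝ)
  (g : Fin (N + 1) → PhaseSpace N → ℝ) (W : ℝ → Fin (N + 1) → Fin (N + 1) → ℝ),
  (∀ s f₁ f₂, lap s f₁ f₂ = ∫ t in Set.Ioi (0 : ℝ), Real.exp (-(s * t)) *
  ((∫ z, f₁ z * (∫ y, f₂ y ∂((pinnedChain ω₂ lam β γ).transitionKernel N T T t.toNNReal z))
  ∂(pinnedChain ω₂ lam β γ).gibbsMeasure N T) -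
  (∫ z, f₁ z ∂(pinnedChain ω₂ lam β γ).gibbsMeasure N T) *
  (∫ z, f₂ z ∂(pinnedChain ω₂ lam β γ).gibbsMeasure N T))) →
  (∀ x z, e x z = z.2 x ^ 2 / 2 + (pinnedChain ω₂ lam β γ).U (z.1 x) +
  ∑ j : Fin N, ((if j.val = x.val + 1 then (pinnedChain ω₂ lam β γ).V (z.1 j - z.1 x) / 2 else 0) +
  (if x.val = j.val + 1 then (pinnedChain ω₂ lam β γ).V (z.1 x - z.1 j) / 2 else 0))) →
  (∀ s, G s = Matrix.of fun x y => lap s (e x) (e y)) →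
  (∀ s f₁ f₂, schur s f₁ f₂ = lap s f₁ f₂ - ∑ x, ∑ y, lap s f₁ (e x) * (G s)⁻¹ x y * lap s (e y) f₂) →
  (∀ i z, g i z = (∑ b : Fin N, if b.val + 1 = i.val then (pinnedChain ω₂ lam β γ).bondCurrent N b z else 0) +
  (∑ x : Fin N, if (i.val = 0 ∧ x.val = 0) ∨ (i.val = N ∧ x.val + 1 = N) then
  (pinnedChain ω₂ lam β γ).γ * (T - z.2 x ^ 2) else 0)) →
  (∀ s i j, W s i j = (if i = j ∧ (i.val = 0 ∨ i.val = N) then (pinnedChain ω₂ lam β γ).γ * T ^ 2 else 0) -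
  schur s (fun z => g i (z.1, -z.2)) (g j)) →
  ∀ s : ℝ, 0 < s → s < s₀ → ∀ i j : Fin (N + 1),
  R + 1 ≤ i.val → i.val + 1 + R ≤ N → R + 1 ≤ j.val → j.val + 1 + R ≤ N →
  i.val ≤ j.val + Z → j.val ≤ i.val + Z → |W s i j - K ((i.val : ℤ) - j.val)| ≤ ε

/-- **(Q1) positivity of the bulk symbol** (= registered stub `stub_symbolPositivity`, rev 2): every bulk limit `K` of
`W_N(s)` in the sense of `BlockBulkLimit` has cosine symbol `K̂(θ) = Σ'_z K(z)cos(zθ) > 0` at every `θ`. The lower half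
`0 ≤ K̂` is `Robin.symbol_nonneg_of_bulkLimit` (landed); `θ = 0` is `PositiveMemory`'s end. Open (qualitative). -/
def BulkSymbolPositivity : Prop :=
  ∀ ω₂ lam β γ : ℝ, 0 < ω₂ → 0 < lam → 0 < β → 0 < γ → ∀ T : ℝ, 0 < T →
  ∀ K : ℤ → ℝ, Summable K →
  (∀ ε : ℝ, 0 < ε → ∀ Z : ℕ, ∃ R : ℕ, ∀ N : ℕ, 2 ≤ N → ∃ s₀ : ℝ, 0 < s₀ ∧
  ∀ (lap : ℝ → (PhaseSpace N → ℝ) → (PhaseSpace N → ℝ) → ℝ) (e : Fin N → PhaseSpace N → ℝ)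
  (G : ℝ → Matrix (Fin N) (Fin N) ℝ) (schur : ℝ → (PhaseSpace N → ℝ) → (PhaseSpace N → ℝ) → ℝ)
  (g : Fin (N + 1) → PhaseSpace N → ℝ) (W : ℝ → Fin (N + 1) → Fin (N + 1) → ℝ),
  (∀ s f₁ f₂, lap s f₁ f₂ = ∫ t in Set.Ioi (0 : ℝ), Real.exp (-(s * t)) *
  ((∫ z, f₁ z * (∫ y, f₂ y ∂((pinnedChain ω₂ lam β γ).transitionKernel N T T t.toNNReal z))
  ∂(pinnedChain ω₂ lam β γ).gibbsMeasure N T) -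
  (∫ z, f₁ z ∂(pinnedChain ω₂ lam β γ).gibbsMeasure N T) *
  (∫ z, f₂ z ∂(pinnedChain ω₂ lam β γ).gibbsMeasure N T))) →
  (∀ x z, e x z = z.2 x ^ 2 / 2 + (pinnedChain ω₂ lam β γ).U (z.1 x) +
  ∑ j : Fin N, ((if j.val = x.val + 1 then (pinnedChain ω₂ lam β γ).V (z.1 j - z.1 x) / 2 else 0) +
  (if x.val = j.val + 1 then (pinnedChain ω₂ lam β γ).V (z.1 x - z.1 j) / 2 else 0))) →
  (∀ s, G s = Matrix.of fun x y => lap s (e x) (e y)) →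
  (∀ s f₁ f₂, schur s f₁ f₂ = lap s f₁ f₂ - ∑ x, ∑ y, lap s f₁ (e x) * (G s)⁻¹ x y * lap s (e y) f₂) →
  (∀ i z, g i z = (∑ b : Fin N, if b.val + 1 = i.val then (pinnedChain ω₂ lam β γ).bondCurrent N b z else 0) +
  (∑ x : Fin N, if (i.val = 0 ∧ x.val = 0) ∨ (i.val = N ∧ x.val + 1 = N) then
  (pinnedChain ω₂ lam β γ).γ * (T - z.2 x ^ 2) else 0)) →
  (∀ s i j, W s i j = (if i = j ∧ (i.val = 0 ∨ i.val = N) then (pinnedChain ω₂ lam β γ).γ * T ^ 2 else 0) -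
  schur s (fun z => g i (z.1, -z.2)) (g j)) →
  ∀ s : ℝ, 0 < s → s < s₀ → ∀ i j : Fin (N + 1),
  R + 1 ≤ i.val → i.val + 1 + R ≤ N → R + 1 ≤ j.val → j.val + 1 + R ≤ N →
  i.val ≤ j.val + Z → j.val ≤ i.val + Z → |W s i j - K ((i.val : ℤ) - j.val)| ≤ ε) →
  ∀ θ : ℝ, 0 < ∑' z : ℤ, K z * Real.cos (z * θ)

/-- **(Q2) corner coercivity** (= registered stub `stub_cornerCoercivity`): there is `m > 0` such that for every window
size `w` there is `N₁` with: for all `N ≥ N₁` (`N ≥ 2`) and small `s > 0`, `vᵀW_N(s)v ≥ m|v|²` for every `v` supported on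
the first `w` or on the last `w` positions — no contact-trapped zero mode; `γ > 0` is load-bearing here
(`Negative.robinCoercivity_false_without_coupling`), and `m ≤ W_00 ≤ γT²` (`Negative.robinConst_le_contact'`). Open. -/
def CornerCoercivity : Prop :=
  ∀ ω₂ lam β γ : ℝ, 0 < ω₂ → 0 < lam → 0 < β → 0 < γ → ∀ T : ℝ, 0 < T →
  ∃ m : ℝ, 0 < m ∧ ∀ w : ℕ, ∃ N₁ : ℕ, ∀ N : ℕ, N₁ ≤ N → 2 ≤ N → ∃ s₀ : ℝ, 0 < s₀ ∧
  ∀ (lap : ℝ → (PhaseSpace N → ℝ) → (PhaseSpace N → ℝ) → ℝ) (e : Fin N → PhaseSpace N → ℝ)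
  (G : ℝ → Matrix (Fin N) (Fin N) ℝ) (schur : ℝ → (PhaseSpace N → ℝ) → (PhaseSpace N → ℝ) → ℝ)
  (g : Fin (N + 1) → PhaseSpace N → ℝ) (W : ℝ → Fin (N + 1) → Fin (N + 1) → ℝ),
  (∀ s f₁ f₂, lap s f₁ f₂ = ∫ t in Set.Ioi (0 : ℝ), Real.exp (-(s * t)) *
  ((∫ z, f₁ z * (∫ y, f₂ y ∂((pinnedChain ω₂ lam β γ).transitionKernel N T T t.toNNReal z))
  ∂(pinnedChain ω₂ lam β γ).gibbsMeasure N T) -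
  (∫ z, f₁ z ∂(pinnedChain ω₂ lam β γ).gibbsMeasure N T) *
  (∫ z, f₂ z ∂(pinnedChain ω₂ lam β γ).gibbsMeasure N T))) →
  (∀ x z, e x z = z.2 x ^ 2 / 2 + (pinnedChain ω₂ lam β γ).U (z.1 x) +
  ∑ j : Fin N, ((if j.val = x.val + 1 then (pinnedChain ω₂ lam β γ).V (z.1 j - z.1 x) / 2 else 0) +
  (if x.val = j.val + 1 then (pinnedChain ω₂ lam β γ).V (z.1 x - z.1 j) / 2 else 0))) →
  (∀ s, G s = Matrix.of fun x y => lap s (e x) (e y)) →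
  (∀ s f₁ f₂, schur s f₁ f₂ = lap s f₁ f₂ - ∑ x, ∑ y, lap s f₁ (e x) * (G s)⁻¹ x y * lap s (e y) f₂) →
  (∀ i z, g i z = (∑ b : Fin N, if b.val + 1 = i.val then (pinnedChain ω₂ lam β γ).bondCurrent N b z else 0) +
  (∑ x : Fin N, if (i.val = 0 ∧ x.val = 0) ∨ (i.val = N ∧ x.val + 1 = N) then
  (pinnedChain ω₂ lam β γ).γ * (T - z.2 x ^ 2) else 0)) →
  (∀ s i j, W s i j = (if i = j ∧ (i.val = 0 ∨ i.val = N) then (pinnedChain ω₂ lam β γ).γ * T ^ 2 else 0) -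
  schur s (fun z => g i (z.1, -z.2)) (g j)) →
  ∀ s : ℝ, 0 < s → s < s₀ →
  (∀ v : Fin (N + 1) → ℝ, (∀ i : Fin (N + 1), w ≤ i.val → v i = 0) →
  m * ∑ i, v i ^ 2 ≤ ∑ i, ∑ j, v i * W s i j * v j) ∧
  (∀ v : Fin (N + 1) → ℝ, (∀ i : Fin (N + 1), i.val + w < N + 1 → v i = 0) →
  m * ∑ i, v i ^ 2 ≤ ∑ i, ∑ j, v i * W s i j * v j)

/-! ### The fixed-`(N, s)` assembly over the route's gadgets -/

/-- **Large-`N` Robin coercivity at fixed `(N, s)`** over abstract gadgets with their defining equations: the block form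
(`stub_blockForm`), the per-`N` clauses of band-domination / bulk limit / corner coercivity (already specialised to this
`N`, with thresholds `s₁, s₂, s₃`), the Toeplitz bound and the smallness of the commutator give
`c·Robin(ξ) ≤ ξᵀ𝔽_N(s)ξ` for every `c ≤ c_w/2`. -/
theorem final_fixedN {ω₂ lam β γ T : ℝ} (hω : 0 < ω₂) (hl : 0 < lam) (hβ : 0 < β) (hγ : 0 < γ) (hT : 0 < T)
    {N : ℕ} (hN : 2 ≤ N) (K : ℤ → ℝ) (τ : ℕ → ℝ) (m₁ m₂ c : ℝ) (D L R : ℕ) (s₁ s₂ s₃ : ℝ)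
    (hL1 : 1 ≤ L) (hm₁ : 0 < m₁) (hc : c ≤ min (m₁ / 2) m₂ / 2)
    (hE : (D : ℝ) ^ 2 / (L : ℝ) ^ 2 * τ 0 + τ D ≤ min (m₁ / 2) m₂ / 10)
    (hToe : ∀ (M : ℕ) (v : Fin M → ℝ), m₁ * ∑ i, v i ^ 2 ≤ ∑ i, ∑ j, v i * K ((i.val : ℤ) - j.val) * v j)
    (hband : ∀ (lap : ℝ → (PhaseSpace N → ℝ) → (PhaseSpace N → ℝ) → ℝ) (e : Fin N → PhaseSpace N → ℝ)
      (G : ℝ → Matrix (Fin N) (Fin N) ℝ) (schur : ℝ → (PhaseSpace N → ℝ) → (PhaseSpace N → ℝ) → ℝ)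
      (g : Fin (N + 1) → PhaseSpace N → ℝ) (W : ℝ → Fin (N + 1) → Fin (N + 1) → ℝ),
    (∀ s f₁ f₂, lap s f₁ f₂ = ∫ t in Set.Ioi (0 : ℝ), Real.exp (-(s * t)) *
      ((∫ z, f₁ z * (∫ y, f₂ y ∂((pinnedChain ω₂ lam β γ).transitionKernel N T T t.toNNReal z))
          ∂(pinnedChain ω₂ lam β γ).gibbsMeasure N T) -
        (∫ z, f₁ z ∂(pinnedChain ω₂ lam β γ).gibbsMeasure N T) *
          (∫ z, f₂ z ∂(pinnedChain ω₂ lam β γ).gibbsMeasure N T))) →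
    (∀ x z, e x z = z.2 x ^ 2 / 2 + (pinnedChain ω₂ lam β γ).U (z.1 x) +
      ∑ j : Fin N, ((if j.val = x.val + 1 then (pinnedChain ω₂ lam β γ).V (z.1 j - z.1 x) / 2 else 0) +
        (if x.val = j.val + 1 then (pinnedChain ω₂ lam β γ).V (z.1 x - z.1 j) / 2 else 0))) →
    (∀ s, G s = Matrix.of fun x y => lap s (e x) (e y)) →
    (∀ s f₁ f₂, schur s f₁ f₂ = lap s f₁ f₂ - ∑ x, ∑ y, lap s f₁ (e x) * (G s)⁻¹ x y * lap s (e y) f₂) →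
    (∀ i z, g i z = (∑ b : Fin N, if b.val + 1 = i.val then (pinnedChain ω₂ lam β γ).bondCurrent N b z else 0) +
      (∑ x : Fin N, if (i.val = 0 ∧ x.val = 0) ∨ (i.val = N ∧ x.val + 1 = N) then
        (pinnedChain ω₂ lam β γ).γ * (T - z.2 x ^ 2) else 0)) →
    (∀ s i j, W s i j = (if i = j ∧ (i.val = 0 ∨ i.val = N) then (pinnedChain ω₂ lam β γ).γ * T ^ 2 else 0) -
      schur s (fun z => g i (z.1, -z.2)) (g j)) →
    ∀ s : ℝ, 0 < s → s < s₁ → ∀ (i : Fin (N + 1)) (d : ℕ),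
      ∑ j : Fin (N + 1), (if (d : ℝ) < |(i.val : ℝ) - j.val| then |W s i j| else 0) ≤ τ d)
    (hbulk : ∀ (lap : ℝ → (PhaseSpace N → ℝ) → (PhaseSpace N → ℝ) → ℝ) (e : Fin N → PhaseSpace N → ℝ)
      (G : ℝ → Matrix (Fin N) (Fin N) ℝ) (schur : ℝ → (PhaseSpace N → ℝ) → (PhaseSpace N → ℝ) → ℝ)
      (g : Fin (N + 1) → PhaseSpace N → ℝ) (W : ℝ → Fin (N + 1) → Fin (N + 1) → ℝ),
    (∀ s f₁ f₂, lap s f₁ f₂ = ∫ t in Set.Ioi (0 : ℝ), Real.exp (-(s * t)) *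
      ((∫ z, f₁ z * (∫ y, f₂ y ∂((pinnedChain ω₂ lam β γ).transitionKernel N T T t.toNNReal z))
          ∂(pinnedChain ω₂ lam β γ).gibbsMeasure N T) -
        (∫ z, f₁ z ∂(pinnedChain ω₂ lam β γ).gibbsMeasure N T) *
          (∫ z, f₂ z ∂(pinnedChain ω₂ lam β γ).gibbsMeasure N T))) →
    (∀ x z, e x z = z.2 x ^ 2 / 2 + (pinnedChain ω₂ lam β γ).U (z.1 x) +
      ∑ j : Fin N, ((if j.val = x.val + 1 then (pinnedChain ω₂ lam β γ).V (z.1 j - z.1 x) / 2 else 0) +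
        (if x.val = j.val + 1 then (pinnedChain ω₂ lam β γ).V (z.1 x - z.1 j) / 2 else 0))) →
    (∀ s, G s = Matrix.of fun x y => lap s (e x) (e y)) →
    (∀ s f₁ f₂, schur s f₁ f₂ = lap s f₁ f₂ - ∑ x, ∑ y, lap s f₁ (e x) * (G s)⁻¹ x y * lap s (e y) f₂) →
    (∀ i z, g i z = (∑ b : Fin N, if b.val + 1 = i.val then (pinnedChain ω₂ lam β γ).bondCurrent N b z else 0) +
      (∑ x : Fin N, if (i.val = 0 ∧ x.val = 0) ∨ (i.val = N ∧ x.val + 1 = N) then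
        (pinnedChain ω₂ lam β γ).γ * (T - z.2 x ^ 2) else 0)) →
    (∀ s i j, W s i j = (if i = j ∧ (i.val = 0 ∨ i.val = N) then (pinnedChain ω₂ lam β γ).γ * T ^ 2 else 0) -
      schur s (fun z => g i (z.1, -z.2)) (g j)) →
    ∀ s : ℝ, 0 < s → s < s₂ → ∀ i j : Fin (N + 1),
      R + 1 ≤ i.val → i.val + 1 + R ≤ N → R + 1 ≤ j.val → j.val + 1 + R ≤ N →
      i.val ≤ j.val + 2 * L → j.val ≤ i.val + 2 * L → |W s i j - K ((i.val : ℤ) - j.val)| ≤ m₁ / (4 * L))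
    (hcorner : ∀ (lap : ℝ → (PhaseSpace N → ℝ) → (PhaseSpace N → ℝ) → ℝ) (e : Fin N → PhaseSpace N → ℝ)
      (G : ℝ → Matrix (Fin N) (Fin N) ℝ) (schur : ℝ → (PhaseSpace N → ℝ) → (PhaseSpace N → ℝ) → ℝ)
      (g : Fin (N + 1) → PhaseSpace N → ℝ) (W : ℝ → Fin (N + 1) → Fin (N + 1) → ℝ),
    (∀ s f₁ f₂, lap s f₁ f₂ = ∫ t in Set.Ioi (0 : ℝ), Real.exp (-(s * t)) *
      ((∫ z, f₁ z * (∫ y, f₂ y ∂((pinnedChain ω₂ lam β γ).transitionKernel N T T t.toNNReal z))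
          ∂(pinnedChain ω₂ lam β γ).gibbsMeasure N T) -
        (∫ z, f₁ z ∂(pinnedChain ω₂ lam β γ).gibbsMeasure N T) *
          (∫ z, f₂ z ∂(pinnedChain ω₂ lam β γ).gibbsMeasure N T))) →
    (∀ x z, e x z = z.2 x ^ 2 / 2 + (pinnedChain ω₂ lam β γ).U (z.1 x) +
      ∑ j : Fin N, ((if j.val = x.val + 1 then (pinnedChain ω₂ lam β γ).V (z.1 j - z.1 x) / 2 else 0) +
        (if x.val = j.val + 1 then (pinnedChain ω₂ lam β γ).V (z.1 x - z.1 j) / 2 else 0))) →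
    (∀ s, G s = Matrix.of fun x y => lap s (e x) (e y)) →
    (∀ s f₁ f₂, schur s f₁ f₂ = lap s f₁ f₂ - ∑ x, ∑ y, lap s f₁ (e x) * (G s)⁻¹ x y * lap s (e y) f₂) →
    (∀ i z, g i z = (∑ b : Fin N, if b.val + 1 = i.val then (pinnedChain ω₂ lam β γ).bondCurrent N b z else 0) +
      (∑ x : Fin N, if (i.val = 0 ∧ x.val = 0) ∨ (i.val = N ∧ x.val + 1 = N) then
        (pinnedChain ω₂ lam β γ).γ * (T - z.2 x ^ 2) else 0)) →
    (∀ s i j, W s i j = (if i = j ∧ (i.val = 0 ∨ i.val = N) then (pinnedChain ω₂ lam β γ).γ * T ^ 2 else 0) -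
      schur s (fun z => g i (z.1, -z.2)) (g j)) →
    ∀ s : ℝ, 0 < s → s < s₃ →
      (∀ v : Fin (N + 1) → ℝ, (∀ i : Fin (N + 1), R + 1 + 2 * L ≤ i.val → v i = 0) →
        m₂ * ∑ i, v i ^ 2 ≤ ∑ i, ∑ j, v i * W s i j * v j) ∧
      (∀ v : Fin (N + 1) → ℝ, (∀ i : Fin (N + 1), i.val + (R + 1 + 2 * L) < N + 1 → v i = 0) →
        m₂ * ∑ i, v i ^ 2 ≤ ∑ i, ∑ j, v i * W s i j * v j))
    (lap : ℝ → (PhaseSpace N → ℝ) → (PhaseSpace N → ℝ) → ℝ)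
    (cov : (PhaseSpace N → ℝ) → (PhaseSpace N → ℝ) → ℝ) (e : Fin N → PhaseSpace N → ℝ)
    (G : ℝ → Matrix (Fin N) (Fin N) ℝ) (schur : ℝ → (PhaseSpace N → ℝ) → (PhaseSpace N → ℝ) → ℝ)
    (F : ℝ → Fin N → Fin N → ℝ) (g : Fin (N + 1) → PhaseSpace N → ℝ)
    (W : ℝ → Fin (N + 1) → Fin (N + 1) → ℝ) (Bv : (Fin N → ℝ) → Fin (N + 1) → ℝ)
    (hlap : ∀ s f₁ f₂, lap s f₁ f₂ = ∫ t in Set.Ioi (0 : ℝ), Real.exp (-(s * t)) *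
      ((∫ z, f₁ z * (∫ y, f₂ y ∂((pinnedChain ω₂ lam β γ).transitionKernel N T T t.toNNReal z))
          ∂(pinnedChain ω₂ lam β γ).gibbsMeasure N T) -
        (∫ z, f₁ z ∂(pinnedChain ω₂ lam β γ).gibbsMeasure N T) *
          (∫ z, f₂ z ∂(pinnedChain ω₂ lam β γ).gibbsMeasure N T)))
    (hcov : ∀ f₁ f₂, cov f₁ f₂ = (∫ z, f₁ z * f₂ z ∂(pinnedChain ω₂ lam β γ).gibbsMeasure N T) -
      (∫ z, f₁ z ∂(pinnedChain ω₂ lam β γ).gibbsMeasure N T) *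
        (∫ z, f₂ z ∂(pinnedChain ω₂ lam β γ).gibbsMeasure N T))
    (he : ∀ x z, e x z = z.2 x ^ 2 / 2 + (pinnedChain ω₂ lam β γ).U (z.1 x) +
      ∑ j : Fin N, ((if j.val = x.val + 1 then (pinnedChain ω₂ lam β γ).V (z.1 j - z.1 x) / 2 else 0) +
        (if x.val = j.val + 1 then (pinnedChain ω₂ lam β γ).V (z.1 x - z.1 j) / 2 else 0)))
    (hG : ∀ s, G s = Matrix.of fun x y => lap s (e x) (e y))
    (hschur : ∀ s f₁ f₂, schur s f₁ f₂ = lap s f₁ f₂ - ∑ x, ∑ y, lap s f₁ (e x) * (G s)⁻¹ x y * lap s (e y) f₂)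
    (hF : ∀ s x y, F s x y = s * cov (e x) (e y) - cov (e x) ((pinnedChain ω₂ lam β γ).generator N T T (e y)) -
      schur s (fun z => (pinnedChain ω₂ lam β γ).generator N T T (e x) (z.1, -z.2))
        ((pinnedChain ω₂ lam β γ).generator N T T (e y)))
    (hg : ∀ i z, g i z = (∑ b : Fin N, if b.val + 1 = i.val then (pinnedChain ω₂ lam β γ).bondCurrent N b z else 0) +
      (∑ x : Fin N, if (i.val = 0 ∧ x.val = 0) ∨ (i.val = N ∧ x.val + 1 = N) then
        (pinnedChain ω₂ lam β γ).γ * (T - z.2 x ^ 2) else 0))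
    (hW : ∀ s i j, W s i j = (if i = j ∧ (i.val = 0 ∨ i.val = N) then (pinnedChain ω₂ lam β γ).γ * T ^ 2 else 0) -
      schur s (fun z => g i (z.1, -z.2)) (g j))
    (hBv : ∀ ξ i, Bv ξ i = if i.val = N then (∑ x : Fin N, if x.val + 1 = N then ξ x else 0)
      else ∑ x : Fin N, ((if x.val = i.val then ξ x else 0) - (if x.val + 1 = i.val then ξ x else 0)))
    {s : ℝ} (hs : 0 < s) (hs1 : s < s₁) (hs2 : s < s₂) (hs3 : s < s₃) (ξ : Fin N → ℝ) :
    c * (∑ i : Fin N, ((∑ j : Fin N, if j.val = i.val + 1 then (ξ j - ξ i) ^ 2 else 0) +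
        (if i.val = 0 then ξ i ^ 2 else 0) + (if i.val = N - 1 then ξ i ^ 2 else 0))) ≤
      ∑ x, ∑ y, ξ x * F s x y * ξ y := by
  obtain ⟨hsym, hcov0, hid, hrob⟩ := stub_blockForm ω₂ lam β γ hω hl hβ hγ T hT N hN lap cov e G schur F g W Bv
    hlap hcov he hG hschur hF hg hW hBv s hs
  have hb := hband lap e G schur g W hlap he hG hschur hg hW s hs hs1
  have hk := hbulk lap e G schur g W hlap he hG hschur hg hW s hs hs2
  obtain ⟨hcl, hcr⟩ := hcorner lap e G schur g W hlap he hG hschur hg hW s hs hs3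
  have hcoer := coercive_of_pieces (W s) K (τ 0) (τ D) m₁ m₂ D L R hL1 hm₁ hsym
    (fun i => hb i 0) (fun i => hb i D) hk (hToe (N + 1)) hcl hcr hE (Bv ξ)
  rw [hid ξ, ← hrob ξ]
  have h1 : 0 ≤ s * ∑ x, ∑ y, ξ x * cov (e x) (e y) * ξ y := mul_nonneg hs.le (hcov0 ξ)
  have hnn : 0 ≤ ∑ i, Bv ξ i ^ 2 := Finset.sum_nonneg fun i _ => sq_nonneg _
  have hcmp : c * ∑ i, Bv ξ i ^ 2 ≤ min (m₁ / 2) m₂ / 2 * ∑ i, Bv ξ i ^ 2 := mul_le_mul_of_nonneg_right hc hnn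
  linarith

/-! ### The transfer theorem -/

/-- **TRANSFER: the four limit-operator inputs imply `RobinCoercivity`.** Hypotheses: the named Props above —
`hband` = (U′) `BlockBandDomination`, `hlim` = (L) `BlockBulkLimit`, `hsymb` = (Q1) `BulkSymbolPositivity`, `hcorner` = (Q2)
`CornerCoercivity` (verbatim the four open stubs of the registered skeleton). Proof: limit objects and constants
first (`τ`, `K_∞`, `m₁` from `stub_toeplitzSymbol`, `m₂`), then the localisation scale (`D`, `L`), the bulk depth `R` and
the corner threshold `N₁`; large `N` by `final_fixedN` (IMS localisation, `stub_imsLocalisation`, over the block form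
`stub_blockForm`), small `N` by the landed pointwise theorem `Robin.robinCoercivity_pointwise`; `c` = finite min. -/
theorem robinCoercivity_of_limitOperatorInputs (hband : BlockBandDomination) (hlim : BlockBulkLimit)
    (hsymb : BulkSymbolPositivity) (hcorner : CornerCoercivity) : RobinCoercivity := by
  unfold BlockBandDomination at hband
  unfold BlockBulkLimit at hlim
  unfold BulkSymbolPositivity at hsymb
  unfold CornerCoercivity at hcorner
  intro ω₂ lam β γ hω hl hβ hγ T hT
  obtain ⟨τ, hτ0, hτN⟩ := hband ω₂ lam β γ hω hl hβ hγ T hT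
  obtain ⟨K, hKs, hKN⟩ := hlim ω₂ lam β γ hω hl hβ hγ T hT
  have hKpos := hsymb ω₂ lam β γ hω hl hβ hγ T hT K hKs hKN
  obtain ⟨m₁, hm₁, hToe⟩ := stub_toeplitzSymbol K hKs hKpos
  obtain ⟨m₂, hm₂, hCor⟩ := hcorner ω₂ lam β γ hω hl hβ hγ T hT
  have hcw : 0 < min (m₁ / 2) m₂ := lt_min (half_pos hm₁) hm₂
  obtain ⟨D, hD⟩ := exists_small_tail τ hτ0 (min (m₁ / 2) m₂ / 20) (by positivity)
  obtain ⟨L, hL1, hL⟩ := exists_natL ((D : ℝ) ^ 2 * max (τ 0) 0) (min (m₁ / 2) m₂ / 20)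
    (by positivity) (by positivity)
  have hLpos : (0 : ℝ) < L := by exact_mod_cast hL1
  have hE : (D : ℝ) ^ 2 / (L : ℝ) ^ 2 * τ 0 + τ D ≤ min (m₁ / 2) m₂ / 10 := by
    have hL2 : (0 : ℝ) < (L : ℝ) ^ 2 := by positivity
    have h1 : (D : ℝ) ^ 2 / (L : ℝ) ^ 2 * τ 0 ≤ (D : ℝ) ^ 2 * max (τ 0) 0 / (L : ℝ) ^ 2 := by
      rw [div_mul_eq_mul_div]
      exact div_le_div_of_nonneg_right (mul_le_mul_of_nonneg_left (le_max_left _ _) (by positivity)) hL2.le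
    linarith
  obtain ⟨R, hR⟩ := hKN (m₁ / (4 * L)) (by positivity) (2 * L)
  obtain ⟨N₁, hN₁⟩ := hCor (R + 1 + 2 * L)
  have hpt := robinCoercivity_pointwise ω₂ lam β γ hω hl hβ hγ T hT
  choose! cN hcNpos hcN using hpt
  obtain ⟨c, hc, hcle, hcsmall⟩ := exists_pos_le_finite (min (m₁ / 2) m₂ / 2) (by positivity)
    (fun n => if 2 ≤ n then cN n else 1)
    (fun n => by
      show 0 < (if 2 ≤ n then cN n else 1)
      split_ifs with h
      · exact hcNpos n h
      · exact one_pos) N₁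
  refine ⟨c, hc, fun N hN => ?_⟩
  by_cases hNN : N₁ ≤ N
  · -- large N: the limit-operator bookkeeping
    obtain ⟨s₁, hs₁, hband⟩ := hτN N hN
    obtain ⟨s₂, hs₂, hbulk⟩ := hR N hN
    obtain ⟨s₃, hs₃, hcorner⟩ := hN₁ N hNN hN
    refine ⟨min s₁ (min s₂ s₃), lt_min hs₁ (lt_min hs₂ hs₃), ?_⟩
    dsimp only
    intro s hs hss ξ
    have hss1 : s < s₁ := lt_of_lt_of_le hss (min_le_left _ _)
    have hss2 : s < s₂ := lt_of_lt_of_le hss ((min_le_right _ _).trans (min_le_left _ _))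
    have hss3 : s < s₃ := lt_of_lt_of_le hss ((min_le_right _ _).trans (min_le_right _ _))
    exact final_fixedN hω hl hβ hγ hT hN K τ m₁ m₂ c D L R s₁ s₂ s₃ hL1 hm₁ hcle hE hToe hband hbulk hcorner
      _ _ _ _ _ _ _ _ _ (fun _ _ _ => rfl) (fun _ _ => rfl) (fun _ _ => rfl) (fun _ => rfl) (fun _ _ _ => rfl)
      (fun _ _ _ => rfl) (fun _ _ => rfl) (fun _ _ _ => rfl) (fun _ _ => rfl) hs hss1 hss2 hss3 ξ
  · -- small N: the landed pointwise theorem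
    refine ⟨1, one_pos, ?_⟩
    have h := hcN N hN
    have hlt : N < N₁ := Nat.lt_of_not_le hNN
    have hcN_le : c ≤ cN N := by
      have := hcsmall N hlt
      simp only [if_pos hN] at this
      exact this
    dsimp only at h ⊢
    intro s hs _ ξ
    exact le_trans (mul_le_mul_of_nonneg_right hcN_le (robinForm_nonneg ξ)) (h s hs ξ)





end Summit.AtomisticToContinuum.FouriersLaw.Theorems.HonestZwanzig.Robin

end
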